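import Mathlib
import HarnessLib

/-!
# FunctionalMining — the algebraic core of the no-crossing criterion (LEMMA NC of the F1 PART II (B4) SPEC)

Search for candidate a priori estimates; no regularity claim. Cell `pub-nsfunc`, prove seat
(gen 21). Kernel form of the no-go seat's kernel candidate K-f (`NoGo/STAGING.md`; LEMMA NC of
`sieveld/x2c/F1-PART2-B4-SPEC.md` §3.1, two-party pen nogo × census-1 — not a cited fact). In an
orthonormal frame `(v, d, n)` adapted to a sector, the matrix `M = tS_j + E(θ)` has the shape

  `M = [[α, 0, w_v], [0, β, w_d], [w_v, w_d, m]]`,  `α − β = 2σ_s`,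

and LEMMA NC says: a DOUBLE eigenvalue `λ` of `M` forces `w_v w_d = 0` and
`(α − β)(λ − m) + (w_v² − w_d²) = 0`. The pen proof divides by `λ − m > 0`; the statement below needs
no such hypothesis: if `M x = λx`, `M y = λy` with `x, y` linearly independent, the rows of `M − λ`
are orthogonal to two independent vectors of `ℝ³`, hence pairwise parallel, so every `2 × 2` minor
of `M − λ` vanishes (cross products; Mathlib `cross_cross_eq_smul_sub_smul'`,
`crossProduct_ne_zero_iff_linearIndependent`).

* `NoCrossing.cross_eq_zero_of_dotProduct_eq_zero` — two vectors orthogonal to two independent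
  vectors of `ℝ³` have zero cross product;
* **`NoCrossing.double_eigenvalue_core`** — LEMMA NC's two identities (no sign hypothesis);
* `NoCrossing.double_eigenvalue_w_eq_zero` (case `α = β`, i.e. `σ_s = 0`: `w = 0`) and
  `NoCrossing.double_eigenvalue_wv_eq_zero` (case `α > β`, `λ > m`: `w_v = 0` and
  `(α − β)(λ − m) = w_d²`) — the rearrangements (a), (b) of the SPEC; (c) is (b) with `v ↔ d`.

Elementary linear algebra over `ℝ`. [ours; folklore]
-/

noncomputable section

open Matrix

namespace Summit.NavierStokesRegularity.FunctionalMining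

namespace NoCrossing

/-! ## 1. Vectors orthogonal to two independent vectors of `ℝ³` are parallel -/

/-- A vector orthogonal to `x` and `y` is parallel to `x ⨯ y`: `(c·c) s = (s·c) c`, `c = x ⨯ y`.
[folklore] -/
theorem smul_eq_smul_cross_of_dotProduct_eq_zero {s x y : Fin 3 → ℝ} (hsx : s ⬝ᵥ x = 0)
    (hsy : s ⬝ᵥ y = 0) :
    ((x ⨯₃ y) ⬝ᵥ (x ⨯₃ y)) • s = (s ⬝ᵥ (x ⨯₃ y)) • (x ⨯₃ y) := by
  have h1 : s ⨯₃ (x ⨯₃ y) = 0 := by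
    rw [cross_cross_eq_smul_sub_smul', hsy, dotProduct_comm x s, hsx, zero_smul, zero_smul, sub_zero]
  have h2 : (x ⨯₃ y) ⨯₃ (s ⨯₃ (x ⨯₃ y)) = 0 := by rw [h1, map_zero]
  rw [cross_cross_eq_smul_sub_smul'] at h2
  exact sub_eq_zero.1 h2

/-- **Two vectors orthogonal to two linearly independent vectors of `ℝ³` have zero cross product**
(they are both multiples of `x ⨯ y ≠ 0`). [folklore] -/
theorem cross_eq_zero_of_dotProduct_eq_zero {r r' x y : Fin 3 → ℝ} (hxy : x ⨯₃ y ≠ 0)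
    (hrx : r ⬝ᵥ x = 0) (hry : r ⬝ᵥ y = 0) (hr'x : r' ⬝ᵥ x = 0) (hr'y : r' ⬝ᵥ y = 0) :
    r ⨯₃ r' = 0 := by
  have hcc : (x ⨯₃ y) ⬝ᵥ (x ⨯₃ y) ≠ 0 := fun h0 => hxy (dotProduct_self_eq_zero.1 h0)
  have hr := smul_eq_smul_cross_of_dotProduct_eq_zero hrx hry
  have hr' := smul_eq_smul_cross_of_dotProduct_eq_zero hr'x hr'y
  have e2 : (((x ⨯₃ y) ⬝ᵥ (x ⨯₃ y)) • r) ⨯₃ (((x ⨯₃ y) ⬝ᵥ (x ⨯₃ y)) • r') = 0 := by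
    rw [hr, hr']
    simp only [map_smul, LinearMap.smul_apply, cross_self, smul_zero]
  have h3 : (((x ⨯₃ y) ⬝ᵥ (x ⨯₃ y)) * ((x ⨯₃ y) ⬝ᵥ (x ⨯₃ y))) • (r ⨯₃ r') = 0 := by
    simpa only [map_smul, LinearMap.smul_apply, smul_smul] using e2
  exact (smul_eq_zero.1 h3).resolve_left (mul_ne_zero hcc hcc)

/-! ## 2. LEMMA NC: a double eigenvalue of `[[α,0,w_v],[0,β,w_d],[w_v,w_d,m]]` -/

/-- **LEMMA NC, algebraic core (kernel candidate K-f).** If `λ` is an eigenvalue of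
`M = [[α, 0, w_v], [0, β, w_d], [w_v, w_d, m]]` with two linearly independent eigenvectors, then
`w_v w_d = 0` and `(α − β)(λ − m) + (w_v² − w_d²) = 0` (all `2 × 2` minors of `M − λ` vanish; no
hypothesis `λ ≠ m` is needed). [folklore; F1 PART II (B4) SPEC §3.1] -/
theorem double_eigenvalue_core {α β m wv wd lam : ℝ} {x y : Fin 3 → ℝ}
    (hxy : LinearIndependent ℝ ![x, y])
    (hx : !![α, 0, wv; 0, β, wd; wv, wd, m] *ᵥ x = lam • x)
    (hy : !![α, 0, wv; 0, β, wd; wv, wd, m] *ᵥ y = lam • y) :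
    wv * wd = 0 ∧ (α - β) * (lam - m) + (wv ^ 2 - wd ^ 2) = 0 := by
  have hc : x ⨯₃ y ≠ 0 := crossProduct_ne_zero_iff_linearIndependent.2 hxy
  -- the three scalar eigen-equations for `x` and for `y`
  have ex0 := congrFun hx 0
  have ex1 := congrFun hx 1
  have ex2 := congrFun hx 2
  have ey0 := congrFun hy 0
  have ey1 := congrFun hy 1
  have ey2 := congrFun hy 2
  simp [Matrix.mulVec, dotProduct, Fin.sum_univ_three] at ex0 ex1 ex2 ey0 ey1 ey2
  -- rows of `M − λ` are orthogonal to `x` and `y`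
  have h0x : ![α - lam, 0, wv] ⬝ᵥ x = 0 := by
    simp [dotProduct, Fin.sum_univ_three]; linarith
  have h0y : ![α - lam, 0, wv] ⬝ᵥ y = 0 := by
    simp [dotProduct, Fin.sum_univ_three]; linarith
  have h1x : ![0, β - lam, wd] ⬝ᵥ x = 0 := by
    simp [dotProduct, Fin.sum_univ_three]; linarith
  have h1y : ![0, β - lam, wd] ⬝ᵥ y = 0 := by
    simp [dotProduct, Fin.sum_univ_three]; linarith
  have h2x : ![wv, wd, m - lam] ⬝ᵥ x = 0 := by
    simp [dotProduct, Fin.sum_univ_three]; linarith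
  have h2y : ![wv, wd, m - lam] ⬝ᵥ y = 0 := by
    simp [dotProduct, Fin.sum_univ_three]; linarith
  -- hence pairwise parallel: the `2 × 2` minors vanish
  have h02 := cross_eq_zero_of_dotProduct_eq_zero hc h0x h0y h2x h2y
  have h12 := cross_eq_zero_of_dotProduct_eq_zero hc h1x h1y h2x h2y
  have m02a : 0 * (m - lam) - wv * wd = 0 := by
    have h := congrFun h02 0
    simp only [cross_apply, Matrix.cons_val_zero, Matrix.cons_val_one, Matrix.cons_val_two,
      Matrix.head_cons, Matrix.tail_cons, Pi.zero_apply] at h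
    exact h
  have m02b : wv * wv - (α - lam) * (m - lam) = 0 := by
    have h := congrFun h02 1
    simp only [cross_apply, Matrix.cons_val_zero, Matrix.cons_val_one, Matrix.cons_val_two,
      Matrix.head_cons, Matrix.tail_cons, Pi.zero_apply] at h
    exact h
  have m12a : (β - lam) * (m - lam) - wd * wd = 0 := by
    have h := congrFun h12 0
    simp only [cross_apply, Matrix.cons_val_zero, Matrix.cons_val_one, Matrix.cons_val_two,
      Matrix.head_cons, Matrix.tail_cons, Pi.zero_apply] at h
    exact h
  constructor
  · linarith
  · linear_combination m02b + m12a

/-- **(a) of LEMMA NC**: if `α = β` (`σ_s = 0`), a double eigenvalue forces `w_v = w_d = 0`.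
[folklore; F1 PART II (B4) SPEC §3.1 (a)] -/
theorem double_eigenvalue_w_eq_zero {α m wv wd lam : ℝ} {x y : Fin 3 → ℝ}
    (hxy : LinearIndependent ℝ ![x, y])
    (hx : !![α, 0, wv; 0, α, wd; wv, wd, m] *ᵥ x = lam • x)
    (hy : !![α, 0, wv; 0, α, wd; wv, wd, m] *ᵥ y = lam • y) : wv = 0 ∧ wd = 0 := by
  obtain ⟨h1, h2⟩ := double_eigenvalue_core hxy hx hy
  rw [sub_self, zero_mul, zero_add, sub_eq_zero] at h2
  rcases mul_eq_zero.1 h1 with h | h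
  · refine ⟨h, ?_⟩
    rw [h] at h2
    nlinarith [sq_nonneg wd]
  · refine ⟨?_, h⟩
    rw [h] at h2
    nlinarith [sq_nonneg wv]

/-- **(b) of LEMMA NC**: if `α > β` (`σ_s > 0`) and `λ > m`, a double eigenvalue forces `w_v = 0` and
`(α − β)(λ − m) = w_d²` (whence the SPEC's bound on `t` through `λ − m ≥ 3tm − 2ε`); (c) is the
mirror statement with `v ↔ d`. [folklore; F1 PART II (B4) SPEC §3.1 (b)] -/
theorem double_eigenvalue_wv_eq_zero {α β m wv wd lam : ℝ} {x y : Fin 3 → ℝ}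
    (hxy : LinearIndependent ℝ ![x, y]) (hαβ : β < α) (hlam : m < lam)
    (hx : !![α, 0, wv; 0, β, wd; wv, wd, m] *ᵥ x = lam • x)
    (hy : !![α, 0, wv; 0, β, wd; wv, wd, m] *ᵥ y = lam • y) :
    wv = 0 ∧ (α - β) * (lam - m) = wd ^ 2 := by
  obtain ⟨h1, h2⟩ := double_eigenvalue_core hxy hx hy
  have hpos : 0 < (α - β) * (lam - m) := mul_pos (sub_pos.2 hαβ) (sub_pos.2 hlam)
  rcases mul_eq_zero.1 h1 with h | h
  · refine ⟨h, ?_⟩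
    rw [h] at h2
    linarith
  · exfalso
    rw [h] at h2
    nlinarith [sq_nonneg wv]

end NoCrossing

end Summit.NavierStokesRegularity.FunctionalMining

end
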